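import Literature.MathematicalPhysics.QuantumFieldTheory.Balaban1983to89.T3MinimiserStabilityReduction
import Literature.MathematicalPhysics.QuantumFieldTheory.Balaban1983to89.T3PrintedRegularMinimiser
import Literature.MathematicalPhysics.QuantumFieldTheory.Balaban1983to89.T3OrbitAverage
import Literature.MathematicalPhysics.QuantumFieldTheory.Balaban1983to89.B12ContinuousTransportInvariance
import Literature.MathematicalPhysics.QuantumFieldTheory.Balaban1983to89.Node00.CanonicalTransportOfRecord
import Summits.QuantumFields.YangMills.Theorems.FluctuationComparisonRegPrIntLWreg
import HarnessLib

/-!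
# LINE g17-1 · «POLYMER-NORM TABLE FOR S2β» — v3 (ideator seat ym-r3-idea-1, generation g18; lens «control»)

Crux of record: `stmt-QuantumFields-20520` (`UnitScaleTilt.FluctuationComparisonRegPrIntL`); package of record
`Cruxes/FluctuationComparisonRegPrIntL/Lines/runpair_organ.lean` (v15), registered input **S2β `FluctuationPartSmall`** (one run, window
log-density PLUS its tree-level part `β_K · minActionRegPr F J K` has κ-clustered connected 4-points `≤ φ J`, `J·φ J → 0`, depth-uniform),
which this file DERIVES from a TABLE written in print's own currency:

* the CONTROLLING QUANTITY (the lens): the exponentially weighted **polymer norm** of a V-LOCAL activity system on the height-`J` window,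
  `N_κ = sup_b Σ_{X ∋ b} wt X · e^{κ·len X}` (`PolymerRepOn`; [Balaban1987RG1] (0.21)–(0.26), [Brydges1986] §3, Dimock arXiv:1108.1335 §3);
* **PC, PROVED** (`fourPoint_le_of_polymerNorm`): polymer norm `≤ N` at rate `κ` ⇒ κ-clustered connected 4-points `≤ 4N·e^{−κ·tdist(b,b′)}`;
* **SFN** (`SmallFieldPolymerNormCan`, stub, XL): `log heightDensityCan^{histGood} + β_K · minActionRegPr` has a V-local polymer representation on the
  window of norm `≤ Φ J`, `J·Φ J → 0`, depth-uniform ([Balaban1987RG1] Thm 1 (0.19)–(0.26) d = 4; d = 3 scalar [Dimock2011] Thm 1; d = 3 YM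
  identity form UNPRINTED);
* **WREG** (`WindowRegularity`, organ stub shared with LINE g17-2 v4, M–L): the window lies in the maximal regular open set of the small-field fibre
  density and its canonical version is POSITIVE on the window (local fibred charts of the iterated averaging; table = LINE g18-2 `Lines/wreg_chart.lean`);
* **SFRᶜ DERIVED** (`smallFieldPolymerRepCan_of_organs : WindowRegularity → SmallFieldPolymerNormCan → SmallFieldPolymerRepCan`, PROVED): positivity
  from WREG, the norm from SFN;
* **LFRᶜ** (`LargeFieldPolymerRepCan`, stub, XL): for every continuous positive window version `ρ` of the FULL nested law, `log ρ − log heightDensityCan^{histGood}`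
  has a V-local polymer representation of norm `≤ Ψ J`, `J·Ψ J → 0`, depth-uniform, given positivity of the canonical version on the window
  ([Balaban1988Convergent] §2 (2.18)–(2.27), [Balaban1989LargeFieldI] §1; d = 3 YM UNPRINTED);
* **COMPOSITION, PROVED** (`fluctuationPartSmall_of_tables : SmallFieldPolymerRepCan → LargeFieldPolymerRepCan → FluctuationPartSmall`, S2β VERBATIM
  from the package): `φ J := 4(Φ J + Ψ J)`, `κ := min κ_S κ_L`.

v3 (2026-08-29, generation g18) = the rule-(4) response to the PLUMB hand's STUB-MISSTATED certificate (`Lines/semiclassical_s2beta_plumb_version.lean`,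
`exists_version_positivity_fails`): v2's SFR / LFR asserted POINTWISE positivity of the trunk's `heightDensity` — a `Classical.choose`-selected
Radon–Nikodym representative at depth ≥ 1 — which can be neither proved nor refuted.  Every row now reads the density through its CANONICAL VERSION
`heightDensityCan := Node00.canonVersion (fieldMeasure …) (heightDensity …)` (a.e. equal to it; continuous on the maximal regular open set `regSet` and there
pointwise determined; tree precedent NODE 00 row P7), exactly as in the hand's offer `Lines/semiclassical_s2beta_plumb_retyped.lean` adopted by LINE g17-2 v4,
and the positivity conjunct is no longer asserted inside the cluster-expansion row but DERIVED from the measure-theoretic organ WREG (coupling-independent,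
counted once for both lines).  v2's p₀-threshold prefix kept.  Sorries = {WREG `stub_windowRegularity`, SFN `stub_smallFieldPolymerNormCan`, LFRᶜ
`stub_largeFieldPolymerRepCan`} — **v5: `stub_windowRegularity` CLOSED BY NAME on F6 ✓p734433
`Summit.QuantumFields.YangMills.Theorems.FluctuationComparisonRegPrIntLWreg.windowRegularity` (the Theorems-side port of LINE g18-2
`Lines/wreg_chart.lean` v20 @7e8eb395e5b4; `Iff.rfl`-identical `WindowRegularity`); live sorries of this line: 2 = {SFN, LFRᶜ}**.  Instrument rows of record: R3 oneloop-4pt family (SIZE/DECAY/DEPTH PASS) reads the small-field 4-point; R3-WREG-RANK (new) for WREG.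

No summit is proved by a line; `YM3TorusSU2` is NOT proved (the package's other inputs S1a, 26243, S2α′, O1 stay open); nothing of Bałaban's asserted.
-/

noncomputable section

open MeasureTheory Filter Topology Set
open Literature.MathematicalPhysics.QuantumFieldTheory.Balaban1983to89
open Literature.MathematicalPhysics.QuantumFieldTheory.Balaban1983to89.T3ContinuumYM3Torus
open Literature.MathematicalPhysics.QuantumFieldTheory.Balaban1983to89.T3NestedUnitLaws
open Literature.MathematicalPhysics.QuantumFieldTheory.Balaban1983to89.T3UnitLawDensityEML
open Literature.MathematicalPhysics.QuantumFieldTheory.Balaban1983to89.T3UnitScaleTilt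
open Literature.MathematicalPhysics.QuantumFieldTheory.Balaban1983to89.T3TiltDescent
open Literature.MathematicalPhysics.QuantumFieldTheory.Balaban1983to89.T3PrintedRegularMinimiser
open Literature.MathematicalPhysics.QuantumFieldTheory.Balaban1983to89.T3ConstrainedMinimiser (fibre)
open Literature.MathematicalPhysics.QuantumFieldTheory.Balaban1983to89.T3LevelShift
open Literature.MathematicalPhysics.QuantumFieldTheory.Balaban1983to89.Missing
open Literature.MathematicalPhysics.QuantumFieldTheory.Balaban1983to89.T4Continuum
open scoped Literature.MathematicalPhysics.QuantumFieldTheory.Balaban1983to89.T3OrbitAverage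

namespace Summit.QuantumFields.YangMills.Cruxes.FluctuationComparisonRegPrIntL.RunPairOrgan.PolymerNorm

/-! ## §1 Polymer calculus: V-local activity systems, the weighted norm, and the PROVED 4-point clustering -/

section PolymerCalculus

variable {P : Params} {G : Type*} {n : ℕ}

/-- **V-LOCALITY**: the activity of polymer `X` depends on the window field only through the bonds of its support `supp X`
([Balaban1987RG1] (0.22) «E(X, ·) depends on the field restricted to X»). [cite: Balaban1987RG1, (0.22)] -/
def IsLocal (supp : Fin n → Finset (PBond P 0)) (act : Fin n → GaugeField P 0 G → ℝ) : Prop :=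
  ∀ X (U U' : GaugeField P 0 G), (∀ e ∈ supp X, U e = U' e) → act X U = act X U'

open Classical in
/-- **A V-LOCAL POLYMER REPRESENTATION OF `f` ON THE WINDOW `W` WITH WEIGHTED NORM `≤ N` AT RATE `κ`**: finitely many polymers `X` with bond
supports, lengths `len X ≥` the source-distance diameter of the support, weights `wt X ≥ sup_W |act X|`, the exponentially weighted norm
`sup_b Σ_{X ∋ b} wt X · e^{κ·len X} ≤ N`, and the IDENTITY `f = c + Σ_X act X` on `W` ([Balaban1987RG1] (0.21)–(0.26); the norm is the
`‖·‖_κ` of [Brydges1986] §3 / Dimock arXiv:1108.1335 (38)). [cite: Balaban1987RG1, (0.23)-(0.26)] -/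
def PolymerRepOn (W : Set (GaugeField P 0 G)) (κ N : ℝ) (f : GaugeField P 0 G → ℝ) : Prop :=
  ∃ (n : ℕ) (supp : Fin n → Finset (PBond P 0)) (len wt : Fin n → ℝ) (act : Fin n → GaugeField P 0 G → ℝ) (c : ℝ),
    IsLocal supp act ∧ (∀ X, 0 ≤ wt X) ∧
    (∀ X, ∀ e ∈ supp X, ∀ e' ∈ supp X, (e.src.tdist e'.src : ℝ) ≤ len X) ∧
    (∀ X U, U ∈ W → |act X U| ≤ wt X) ∧
    (∀ e : PBond P 0, ∑ X ∈ Finset.univ.filter (fun X => e ∈ supp X), wt X * Real.exp (κ * len X) ≤ N) ∧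
    ∀ U, U ∈ W → f U = c + ∑ X, act X U

open Classical in
/-- **PC · POLYMER NORM ⇒ κ-CLUSTERED CONNECTED 4-POINTS (PROVED)**: under the four one-bond window moves of S2β at bonds `b, b′`, the
polymers whose support misses `b` or misses `b′` cancel EXACTLY by V-locality; each survivor contributes `≤ 4·wt X ≤ 4·wt X·e^{κ len X}·e^{−κ·tdist(b,b′)}`
(`len X ≥ tdist`), and the weighted norm sums them: `|Δ_bΔ_{b′}(c + Σ act)| ≤ 4N·e^{−κ·tdist(b,b′)}`. [cite: Balaban1987RG1, (0.23)-(0.26)] -/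
theorem fourPoint_le_of_polymerNorm (W : Set (GaugeField P 0 G)) (supp : Fin n → Finset (PBond P 0)) (len wt : Fin n → ℝ)
    (act : Fin n → GaugeField P 0 G → ℝ) (κ N c : ℝ) (hκ : 0 ≤ κ) (hloc : IsLocal supp act) (hwt : ∀ X, 0 ≤ wt X)
    (hdiam : ∀ X, ∀ e ∈ supp X, ∀ e' ∈ supp X, (e.src.tdist e'.src : ℝ) ≤ len X)
    (hbd : ∀ X U, U ∈ W → |act X U| ≤ wt X)
    (hcov : ∀ e : PBond P 0, ∑ X ∈ Finset.univ.filter (fun X => e ∈ supp X), wt X * Real.exp (κ * len X) ≤ N)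
    (b b' : PBond P 0) (U V Y Z : GaugeField P 0 G) (hU : U ∈ W) (hV : V ∈ W) (hY : Y ∈ W) (hZ : Z ∈ W)
    (hUV : ∀ e, e ≠ b → U e = V e) (hUY : ∀ e, e ≠ b' → U e = Y e) (hVZ : ∀ e, e ≠ b' → V e = Z e)
    (hYZ : ∀ e, e ≠ b → Y e = Z e) :
    |((c + ∑ X, act X U) - (c + ∑ X, act X V)) - ((c + ∑ X, act X Y) - (c + ∑ X, act X Z))|
      ≤ 4 * N * Real.exp (-(κ * (b.src.tdist b'.src : ℝ))) := by
  set d : ℝ := (b.src.tdist b'.src : ℝ) with hd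
  have hT : ((c + ∑ X, act X U) - (c + ∑ X, act X V)) - ((c + ∑ X, act X Y) - (c + ∑ X, act X Z))
      = ∑ X, ((act X U - act X V) - (act X Y - act X Z)) := by
    simp only [Finset.sum_sub_distrib]; ring
  rw [hT]
  have hpt : ∀ X, |(act X U - act X V) - (act X Y - act X Z)|
      ≤ if b ∈ supp X then 4 * (wt X * Real.exp (κ * len X)) * Real.exp (-(κ * d)) else 0 := by
    intro X
    by_cases hb : b ∈ supp X
    · rw [if_pos hb]
      by_cases hb' : b' ∈ supp X
      · have hdle : d ≤ len X := hdiam X b hb b' hb'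
        have hkey : wt X ≤ wt X * Real.exp (κ * len X) * Real.exp (-(κ * d)) := by
          rw [mul_assoc, ← Real.exp_add]
          have h0 : 0 ≤ κ * len X + -(κ * d) := by nlinarith
          calc wt X = wt X * 1 := (mul_one _).symm
            _ ≤ wt X * Real.exp (κ * len X + -(κ * d)) := mul_le_mul_of_nonneg_left (Real.one_le_exp h0) (hwt X)
        have h1 := abs_le.mp (hbd X U hU)
        have h2 := abs_le.mp (hbd X V hV)
        have h3 := abs_le.mp (hbd X Y hY)
        have h4 := abs_le.mp (hbd X Z hZ)
        have h5 : |(act X U - act X V) - (act X Y - act X Z)| ≤ 4 * wt X :=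
          abs_le.mpr ⟨by linarith [h1.1, h2.2, h3.2, h4.1], by linarith [h1.2, h2.1, h3.1, h4.2]⟩
        calc |(act X U - act X V) - (act X Y - act X Z)| ≤ 4 * wt X := h5
          _ ≤ 4 * (wt X * Real.exp (κ * len X) * Real.exp (-(κ * d))) := by linarith
          _ = 4 * (wt X * Real.exp (κ * len X)) * Real.exp (-(κ * d)) := by ring
      · have e1 : act X U = act X Y := hloc X U Y (fun e he => hUY e (fun h => hb' (h ▸ he)))
        have e2 : act X V = act X Z := hloc X V Z (fun e he => hVZ e (fun h => hb' (h ▸ he)))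
        have hw := hwt X
        rw [e1, e2]
        simp only [sub_self, abs_zero]
        positivity
    · rw [if_neg hb]
      have e1 : act X U = act X V := hloc X U V (fun e he => hUV e (fun h => hb (h ▸ he)))
      have e2 : act X Y = act X Z := hloc X Y Z (fun e he => hYZ e (fun h => hb (h ▸ he)))
      rw [e1, e2]
      simp only [sub_self, abs_zero, le_refl]
  calc |∑ X, ((act X U - act X V) - (act X Y - act X Z))|
      ≤ ∑ X, |(act X U - act X V) - (act X Y - act X Z)| := Finset.abs_sum_le_sum_abs _ _
    _ ≤ ∑ X, (if b ∈ supp X then 4 * (wt X * Real.exp (κ * len X)) * Real.exp (-(κ * d)) else 0) :=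
        Finset.sum_le_sum (fun X _ => hpt X)
    _ = (∑ X ∈ Finset.univ.filter (fun X => b ∈ supp X), wt X * Real.exp (κ * len X)) * (4 * Real.exp (-(κ * d))) := by
        rw [Finset.sum_filter, Finset.sum_mul]
        refine Finset.sum_congr rfl (fun X _ => ?_)
        split_ifs <;> ring
    _ ≤ N * (4 * Real.exp (-(κ * d))) := by
        have h4 : 0 ≤ 4 * Real.exp (-(κ * d)) := by positivity
        exact mul_le_mul_of_nonneg_right (hcov b) h4
    _ = 4 * N * Real.exp (-(κ * d)) := by ring

/-- **PC in representation form**: a function with a V-local polymer representation of norm `≤ N` at rate `κ ≥ 0` on `W` has κ-clustered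
connected 4-points `≤ 4N e^{−κ·tdist(b,b′)}` under the four one-bond moves inside `W`. [cite: Balaban1987RG1, (0.23)-(0.26)] -/
theorem fourPoint_le_of_polymerRepOn {W : Set (GaugeField P 0 G)} {κ N : ℝ} {f : GaugeField P 0 G → ℝ}
    (h : PolymerRepOn W κ N f) (hκ : 0 ≤ κ)
    (b b' : PBond P 0) (U V Y Z : GaugeField P 0 G) (hU : U ∈ W) (hV : V ∈ W) (hY : Y ∈ W) (hZ : Z ∈ W)
    (hUV : ∀ e, e ≠ b → U e = V e) (hUY : ∀ e, e ≠ b' → U e = Y e) (hVZ : ∀ e, e ≠ b' → V e = Z e)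
    (hYZ : ∀ e, e ≠ b → Y e = Z e) :
    |(f U - f V) - (f Y - f Z)| ≤ 4 * N * Real.exp (-(κ * (b.src.tdist b'.src : ℝ))) := by
  obtain ⟨n, supp, len, wt, act, c, hloc, hwt, hdiam, hbd, hcov, hrep⟩ := h
  rw [hrep U hU, hrep V hV, hrep Y hY, hrep Z hZ]
  exact fourPoint_le_of_polymerNorm W supp len wt act κ N c hκ hloc hwt hdiam hbd hcov b b' U V Y Z hU hV hY hZ hUV hUY hVZ hYZ

open Classical in
/-- **NORM ZERO ⇒ the trivial representation**: a function constant on `W` has a polymer representation of norm `0` (no polymers) — the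
sanity instance showing the predicate is inhabited exactly by what it should be at norm zero. [cite: Balaban1987RG1, (0.23)-(0.26)] -/
theorem polymerRepOn_of_const (W : Set (GaugeField P 0 G)) (κ c : ℝ) (f : GaugeField P 0 G → ℝ) (hf : ∀ U, U ∈ W → f U = c) :
    PolymerRepOn W κ 0 f := by
  refine ⟨0, Fin.elim0, Fin.elim0, Fin.elim0, Fin.elim0, c, ?_, ?_, ?_, ?_, ?_, ?_⟩
  · intro X; exact Fin.elim0 X
  · intro X; exact Fin.elim0 X
  · intro X; exact Fin.elim0 X
  · intro X; exact Fin.elim0 X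
  · intro e; exact (Finset.sum_eq_zero fun X _ => Fin.elim0 X).le
  · intro U hU; simp [hf U hU]

end PolymerCalculus

/-! ## §1c The canonical version of the restricted height density (restated verbatim from LINE g17-2 v4 / the PLUMB hand's offer) -/

section Canonical

variable (F : T3Family) (γ : ℝ) {J K : ℕ} (hJK : J ≤ K) (S : Set (GaugeField (F.P K) 0 (Matrix.specialUnitaryGroup (Fin 2) ℂ)))

/-- **THE CANONICAL VERSION OF BAŁABAN'S RESTRICTED DENSITY AT HEIGHT `K − J`** read on the `J`-th tower's finest lattice: the trunk's `heightDensity`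
(a chosen Radon–Nikodym version) replaced by `Node00.canonVersion` of its a.e.-class for product Haar — continuous on the maximal open set carrying a
continuous representative and equal there to every such representative. [cite: Balaban1985UV3, (2) p.256 and (41) p.266] -/
def heightDensityCan (V : GaugeField (F.P J) 0 (Matrix.specialUnitaryGroup (Fin 2) ℂ)) : ℝ :=
  Node00.canonVersion (fieldMeasure (F.P J) 0 (Matrix.specialUnitaryGroup (Fin 2) ℂ)) (heightDensity F γ hJK S) V

/-- The canonical version IS a version: `heightDensityCan = heightDensity` a.e. (no hypothesis). [cite: Balaban1985UV3, (2) p.256] -/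
theorem heightDensityCan_ae_eq :
    heightDensityCan F γ hJK S =ᵐ[fieldMeasure (F.P J) 0 (Matrix.specialUnitaryGroup (Fin 2) ℂ)] heightDensity F γ hJK S :=
  Node00.canonVersion_ae_eq

/-- The canonical version is continuous on the maximal regular open set of the a.e.-class. [cite: Balaban1985UV3, (2) p.256] -/
theorem continuousOn_heightDensityCan :
    ContinuousOn (heightDensityCan F γ hJK S)
      (Node00.regSet (fieldMeasure (F.P J) 0 (Matrix.specialUnitaryGroup (Fin 2) ℂ)) (heightDensity F γ hJK S)) := by
  haveI := B12ContinuousTransportInvariance.isOpenPosMeasure_fieldMeasure_SU (N := 2) (F.P J) 0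
  exact Node00.continuousOn_canonVersion

end Canonical

/-! ## §2 The rows of the table over the canonical version, the organ WREG, and S2β restated verbatim -/

/-- **WREG · WINDOW REGULARITY OF THE SMALL-FIELD FIBRE DENSITY** (ORGAN, stub; M–L; restated VERBATIM from LINE g17-2 v4 `Lines/semiclassical_s2beta.lean`, counted
once): for every block size `L`, thresholds `b₀, p₀ > 0`, there is `γ₁ > 0` such that for every family with `F.L = L`, `0 < γ ≤ γ₁`, every run `K`, height `J ≤ K` and
EVERY weight coupling `γ′ > 0`: **(R)** the `θ_J(γ)`-window lies in `Node00.regSet` of `heightDensity F γ′ hJK (histGood at θBal γ)`, and **(P)** the canonical version is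
positive on the window.  Mechanism / why it might fail / falsifier: see LINE g17-2 v4 and the table LINE g18-2 `Lines/wreg_chart.lean`.
[cite: Balaban1985Averaging, (10) p.19; Balaban1987RG1, (0.13) p.254 and (2.10) p.267; Balaban1985UV3, (2) p.256] -/
def WindowRegularity : Prop :=
  ∀ (L : ℕ) (b₀ p₀ : ℝ), 0 < b₀ → 0 < p₀ → ∃ γ₁ : ℝ, 0 < γ₁ ∧ ∀ (F : T3Family) (γ : ℝ), F.L = L → 0 < γ → γ ≤ γ₁ →
    ∀ (J K : ℕ) (hJK : J ≤ K) (γ' : ℝ), 0 < γ' →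
      {U : GaugeField (F.P J) 0 (Matrix.specialUnitaryGroup (Fin 2) ℂ) | PlaqSmall (θBal F.L γ b₀ p₀ J) U} ⊆
          Node00.regSet (fieldMeasure (F.P J) 0 (Matrix.specialUnitaryGroup (Fin 2) ℂ))
            (heightDensity F γ' hJK (histGood F ℰp (θBal F.L γ b₀ p₀) K J)) ∧
      ∀ U : GaugeField (F.P J) 0 (Matrix.specialUnitaryGroup (Fin 2) ℂ), PlaqSmall (θBal F.L γ b₀ p₀ J) U →
          0 < heightDensityCan F γ' hJK (histGood F ℰp (θBal F.L γ b₀ p₀) K J) U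

/-- **SFN · SMALL-FIELD POLYMER NORM OVER THE CANONICAL VERSION (stub; XL — the cluster-expansion row, positivity NOT asserted here)**: for every run `K` and height
`J ≤ K`, `log heightDensityCan^{histGood} + β_K · minActionRegPr F J K` (the fluctuation part of the small-history density read through its canonical version: print
expands (41) around exactly this background) has a V-LOCAL POLYMER REPRESENTATION on the window of weighted norm `≤ Φ J` at a rate `κ > 0`, with `J · Φ J → 0` and `Φ`
INDEPENDENT OF THE DEPTH `K − J`.  Print: d = 4 small-field effective densities `exp(−A(ψ_k) + Σ_X E^{(k)}(X, ψ_k))`, `E^{(k)}` analytic, localized,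
`|E^{(k)}(X)| ≤ O(1) e^{−κ d_k(X)}`, [Balaban1987RG1] Thm 1 (0.19)–(0.26), [Balaban1988Convergent] Thm 1; d = 3 scalar QED version [Dimock2011] (arXiv:1108.1335)
Thm 1; at d = 3 the activities carry the extra smallness `g_J² p(g_J)^a` (superrenormalisability), whence `J·Φ J → 0`.  Why it might fail: (i) the IDENTITY form with
activities V-local AT THE DATUM is printed only inequality-level / one-step-level for d = 3 YM; (ii) the K-uniformity is the convergence of the whole small-field
expansion; (iii) on window points where the canonical version vanished the row would speak of junk values of `Real.log` (WREG says there are none).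
[cite: Balaban1987RG1, Thm 1 (0.19)-(0.26); Balaban1985UV3, (41) p.266] -/
def SmallFieldPolymerNormCan : Prop :=
  ∀ (L : ℕ), ∃ pS : ℝ, ∀ (b₀ p₀ : ℝ), 0 < b₀ → pS ≤ p₀ → 0 < p₀ → ∃ ε₁ : ℝ, 0 < ε₁ ∧ ∀ (ε₀ : ℝ), 0 < ε₀ → ε₀ ≤ ε₁ →
    ∃ γ₁ : ℝ, 0 < γ₁ ∧ ∃ κ : ℝ, 0 < κ ∧ ∀ (F : T3Family) (γ : ℝ), F.L = L → 0 < γ → γ ≤ γ₁ →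
      ∃ Φ : ℕ → ℝ, (∀ J, 0 ≤ Φ J) ∧ Tendsto (fun J : ℕ => (J : ℝ) * Φ J) atTop (𝓝 0) ∧
        ∀ (J K : ℕ) (hJK : J ≤ K),
          PolymerRepOn {U | PlaqSmall (θBal F.L γ b₀ p₀ J) U} κ (Φ J)
            (fun U => Real.log (heightDensityCan F γ hJK (histGood F ℰp (θBal F.L γ b₀ p₀) K J) U)
              + (F.scheme ℰp γ).β K * minActionRegPr F J K hJK ε₀ U)

/-- **SFRᶜ · SMALL-FIELD POLYMER REPRESENTATION OVER THE CANONICAL VERSION** (v2's SFR re-typed; DERIVED below from WREG ∧ SFN, no longer a stub): positivity of the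
canonical small-history density on the window AND the polymer representation of norm `≤ Φ J`. [cite: Balaban1987RG1, Thm 1 (0.19)-(0.26); Balaban1985UV3, (41) p.266] -/
def SmallFieldPolymerRepCan : Prop :=
  ∀ (L : ℕ), ∃ pS : ℝ, ∀ (b₀ p₀ : ℝ), 0 < b₀ → pS ≤ p₀ → 0 < p₀ → ∃ ε₁ : ℝ, 0 < ε₁ ∧ ∀ (ε₀ : ℝ), 0 < ε₀ → ε₀ ≤ ε₁ →
    ∃ γ₁ : ℝ, 0 < γ₁ ∧ ∃ κ : ℝ, 0 < κ ∧ ∀ (F : T3Family) (γ : ℝ), F.L = L → 0 < γ → γ ≤ γ₁ →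
      ∃ Φ : ℕ → ℝ, (∀ J, 0 ≤ Φ J) ∧ Tendsto (fun J : ℕ => (J : ℝ) * Φ J) atTop (𝓝 0) ∧
        ∀ (J K : ℕ) (hJK : J ≤ K),
          (∀ U : GaugeField (F.P J) 0 (Matrix.specialUnitaryGroup (Fin 2) ℂ), PlaqSmall (θBal F.L γ b₀ p₀ J) U →
              0 < heightDensityCan F γ hJK (histGood F ℰp (θBal F.L γ b₀ p₀) K J) U) ∧
          PolymerRepOn {U | PlaqSmall (θBal F.L γ b₀ p₀ J) U} κ (Φ J)
            (fun U => Real.log (heightDensityCan F γ hJK (histGood F ℰp (θBal F.L γ b₀ p₀) K J) U)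
              + (F.scheme ℰp γ).β K * minActionRegPr F J K hJK ε₀ U)

/-- **LFRᶜ · LARGE-FIELD POLYMER REMAINDER OVER THE CANONICAL VERSION (stub; XL)**: for every run `K`, height `J ≤ K` and every continuous positive window version `ρ`
of the FULL nested law `ν K J` (S2β's data), `log ρ − log heightDensityCan^{histGood}` — the log of `1 +` (large-field histories)/(small-field histories), constants
free — has a V-local polymer representation on the window of weighted norm `≤ Ψ J` at a rate `κ > 0`, `J · Ψ J → 0`, `Ψ` independent of the depth, GIVEN positivity
of the canonical small-history density on the window.  Print: the R-operation writing the density restrictions `χ = Σ (1 − χ^c)…` as a convergent Mayer series of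
exponentially small, localized large-field activities (`exp(−c·p(g_j)²)` per large plaquette at height `j` against the entropy `L^{3}` per step), [Balaban1988Convergent]
§2 (2.18)–(2.27), [Balaban1989LargeFieldI] §1 (1.10)–(1.25); d = 3 YM UNPRINTED in this form.  Why it might fail: (i) for `p₀ ≤ 1/2` the factor
`exp(−c b₀²(1 + log g_j⁻¹)^{2p₀})` does NOT beat the entropy `L^{3j}` (hence the threshold `pS`); (ii) V-locality of the remainder AT THE DATUM needs the same
re-localisation through the background as SFN.  (Same text as LINE g17-2 v4's `LargeFieldPolymerRepCan`.) [cite: Balaban1988Convergent, §2 (2.18)-(2.27); Balaban1989LargeFieldI, §1] -/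
def LargeFieldPolymerRepCan : Prop :=
  ∀ (L : ℕ), ∃ pS : ℝ, ∀ (b₀ p₀ : ℝ), 0 < b₀ → pS ≤ p₀ → 0 < p₀ →
    ∃ γ₁ : ℝ, 0 < γ₁ ∧ ∃ κ : ℝ, 0 < κ ∧ ∀ (F : T3Family) (γ : ℝ), F.L = L → 0 < γ → γ ≤ γ₁ →
      ∃ Ψ : ℕ → ℝ, (∀ J, 0 ≤ Ψ J) ∧ Tendsto (fun J : ℕ => (J : ℝ) * Ψ J) atTop (𝓝 0) ∧
        ∀ (ν : ℕ → (j : ℕ) → Measure (GaugeField (F.P j) 0 (Matrix.specialUnitaryGroup (Fin 2) ℂ))),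
          (∀ K, ν K K = T4GenFunBounds.gibbsMeasure (F.P K) ((F.scheme ℰp γ).β K)) →
          (∀ K j, j < K → ν K j = Measure.map (descend F ℰp j) (ν K (j + 1))) →
          ∀ (J K : ℕ) (hJK : J ≤ K) (ρ : GaugeField (F.P J) 0 (Matrix.specialUnitaryGroup (Fin 2) ℂ) → ℝ),
            (∀ U, PlaqSmall (θBal F.L γ b₀ p₀ J) U → 0 < ρ U) →
            ν K J = (fieldMeasure _ _ _).withDensity (fun U => ENNReal.ofReal (ρ U)) →
            ContinuousOn ρ {U | PlaqSmall (θBal F.L γ b₀ p₀ J) U} →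
            (∀ U : GaugeField (F.P J) 0 (Matrix.specialUnitaryGroup (Fin 2) ℂ), PlaqSmall (θBal F.L γ b₀ p₀ J) U →
                0 < heightDensityCan F γ hJK (histGood F ℰp (θBal F.L γ b₀ p₀) K J) U) →
            PolymerRepOn {U | PlaqSmall (θBal F.L γ b₀ p₀ J) U} κ (Ψ J)
              (fun U => Real.log (ρ U) - Real.log (heightDensityCan F γ hJK (histGood F ℰp (θBal F.L γ b₀ p₀) K J) U))

/-- **S2β · FLUCTUATION PART SMALL IN 4-POINT CURRENCY** — RESTATED VERBATIM from `Lines/runpair_organ.lean` (v5–v14, the package's registered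
input `stub_fluctuationPartSmall`; same namespace prefix, same text, so the package's `yM3TorusSU2_of_seedTables` consumes this file's
`fluctuationPartSmall_of_stubs` by name). [cite: Balaban1985UV3, Thm 2 p.263 and (41) p.266] -/
def FluctuationPartSmall : Prop :=
  ∀ (L : ℕ), ∃ pS : ℝ, ∀ (b₀ p₀ : ℝ), 0 < b₀ → pS ≤ p₀ → 0 < p₀ → ∃ ε₁ : ℝ, 0 < ε₁ ∧ ∀ (ε₀ : ℝ), 0 < ε₀ → ε₀ ≤ ε₁ →
    ∃ γ₁ : ℝ, 0 < γ₁ ∧ ∃ κ : ℝ, 0 < κ ∧ ∀ (F : T3Family) (γ : ℝ), F.L = L → 0 < γ → γ ≤ γ₁ →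
      ∃ (φ : ℕ → ℝ), (∀ J, 0 ≤ φ J) ∧ Tendsto (fun J : ℕ => (J : ℝ) * φ J) atTop (𝓝 0) ∧
        ∀ (ν : ℕ → (j : ℕ) → Measure (GaugeField (F.P j) 0 (Matrix.specialUnitaryGroup (Fin 2) ℂ))),
          (∀ K, ν K K = T4GenFunBounds.gibbsMeasure (F.P K) ((F.scheme ℰp γ).β K)) →
          (∀ K j, j < K → ν K j = Measure.map (descend F ℰp j) (ν K (j + 1))) →
          ∀ (J K : ℕ) (hJK : J ≤ K) (ρ : GaugeField (F.P J) 0 (Matrix.specialUnitaryGroup (Fin 2) ℂ) → ℝ),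
            (∀ U, PlaqSmall (θBal F.L γ b₀ p₀ J) U → 0 < ρ U) →
            ν K J = (fieldMeasure _ _ _).withDensity (fun U => ENNReal.ofReal (ρ U)) →
            ContinuousOn ρ {U | PlaqSmall (θBal F.L γ b₀ p₀ J) U} →
            ∀ (b b' : PBond (F.P J) 0) (U V W Z : GaugeField (F.P J) 0 (Matrix.specialUnitaryGroup (Fin 2) ℂ)),
              PlaqSmall (θBal F.L γ b₀ p₀ J) U → PlaqSmall (θBal F.L γ b₀ p₀ J) V →
              PlaqSmall (θBal F.L γ b₀ p₀ J) W → PlaqSmall (θBal F.L γ b₀ p₀ J) Z →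
              (∀ e, e ≠ b → U e = V e) → (∀ e, e ≠ b' → U e = W e) → (∀ e, e ≠ b' → V e = Z e) → (∀ e, e ≠ b → W e = Z e) →
              |((Real.log (ρ U) + (F.scheme ℰp γ).β K * minActionRegPr F J K hJK ε₀ U)
                  - (Real.log (ρ V) + (F.scheme ℰp γ).β K * minActionRegPr F J K hJK ε₀ V))
                - ((Real.log (ρ W) + (F.scheme ℰp γ).β K * minActionRegPr F J K hJK ε₀ W)
                  - (Real.log (ρ Z) + (F.scheme ℰp γ).β K * minActionRegPr F J K hJK ε₀ Z))|
                ≤ φ J * Real.exp (-(κ * (b.src.tdist b'.src : ℝ)))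

/-! ## §3 PROVED: SFRᶜ from the organs WREG ∧ SFN, and the composition SFRᶜ → LFRᶜ → S2β -/

/-- **SFRᶜ ⇐ WREG ∧ SFN (PROVED)**: positivity of the canonical version on the window from WREG at the weight coupling `γ′ := γ`, the norm from SFN; `γ₁ := min`.
[cite: Balaban1985UV3, (2) p.256 and (41) p.266] -/
theorem smallFieldPolymerRepCan_of_organs (hW : WindowRegularity) (hN : SmallFieldPolymerNormCan) : SmallFieldPolymerRepCan := by
  intro L
  obtain ⟨pS, hNL⟩ := hN L
  refine ⟨pS, fun b₀ p₀ hb hpS hp => ?_⟩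
  obtain ⟨γW, hγW, hWL⟩ := hW L b₀ p₀ hb hp
  obtain ⟨ε₁, hε₁, hN1⟩ := hNL b₀ p₀ hb hpS hp
  refine ⟨ε₁, hε₁, fun ε₀ hε₀ hε₀1 => ?_⟩
  obtain ⟨γN, hγN, κ, hκ, hN2⟩ := hN1 ε₀ hε₀ hε₀1
  refine ⟨min γW γN, lt_min hγW hγN, κ, hκ, fun F γ hFL hγ hγ1 => ?_⟩
  obtain ⟨Φ, hΦ0, hΦt, hN3⟩ := hN2 F γ hFL hγ (hγ1.trans (min_le_right _ _))
  refine ⟨Φ, hΦ0, hΦt, fun J K hJK => ⟨?_, hN3 J K hJK⟩⟩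
  exact (hWL F γ hFL hγ (hγ1.trans (min_le_left _ _)) J K hJK γ hγ).2


/-- **COMPOSITION · SFRᶜ → LFRᶜ → S2β (PROVED, v2 proof over the canonical version)**: split `log ρ + β_K S = (log g + β_K S) + (log ρ − log g)` with `g` the canonical small-history
density, bound each connected 4-point by PC at the weaker rate `κ := min κ_S κ_L`, and add: `φ J := 4(Φ J + Ψ J)`, `J·φ J → 0`.
[cite: Balaban1987RG1, (0.23)-(0.26); Balaban1988Convergent, §2 (2.18)-(2.27)] -/
theorem fluctuationPartSmall_of_tables (hS : SmallFieldPolymerRepCan) (hL : LargeFieldPolymerRepCan) : FluctuationPartSmall := by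
  intro L
  obtain ⟨pS₁, hSL⟩ := hS L
  obtain ⟨pS₂, hLL⟩ := hL L
  refine ⟨max pS₁ pS₂, fun b₀ p₀ hb hpS hp => ?_⟩
  obtain ⟨ε₁, hε₁, hS1⟩ := hSL b₀ p₀ hb ((le_max_left _ _).trans hpS) hp
  obtain ⟨γL, hγL, κL, hκL, hL1⟩ := hLL b₀ p₀ hb ((le_max_right _ _).trans hpS) hp
  refine ⟨ε₁, hε₁, fun ε₀ hε₀ hε₀1 => ?_⟩
  obtain ⟨γS, hγS, κS, hκS, hS2⟩ := hS1 ε₀ hε₀ hε₀1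
  refine ⟨min γS γL, lt_min hγS hγL, min κS κL, lt_min hκS hκL, fun F γ hFL hγ hγ1 => ?_⟩
  obtain ⟨Φ, hΦ0, hΦt, hS3⟩ := hS2 F γ hFL hγ (hγ1.trans (min_le_left _ _))
  obtain ⟨Ψ, hΨ0, hΨt, hL3⟩ := hL1 F γ hFL hγ (hγ1.trans (min_le_right _ _))
  refine ⟨fun J => 4 * (Φ J + Ψ J), fun J => ?_, ?_, ?_⟩
  · have := hΦ0 J; have := hΨ0 J; positivity
  · have h := (hΦt.add hΨt).const_mul 4
    rw [add_zero, mul_zero] at h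
    refine h.congr' (Eventually.of_forall fun J => ?_)
    show 4 * ((J : ℝ) * Φ J + (J : ℝ) * Ψ J) = (J : ℝ) * (4 * (Φ J + Ψ J))
    ring
  · intro ν hνK hνd J K hJK ρ hρpos hνρ hρcont b b' U V W Z hU hV hW hZ hUV hUW hVZ hWZ
    obtain ⟨hgpos, hrepS⟩ := hS3 J K hJK
    have hrepL := hL3 ν hνK hνd J K hJK ρ hρpos hνρ hρcont hgpos
    have h1 := fourPoint_le_of_polymerRepOn hrepS hκS.le b b' U V W Z hU hV hW hZ hUV hUW hVZ hWZ
    have h2 := fourPoint_le_of_polymerRepOn hrepL hκL.le b b' U V W Z hU hV hW hZ hUV hUW hVZ hWZ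
    beta_reduce at h1 h2
    set g : GaugeField (F.P J) 0 (Matrix.specialUnitaryGroup (Fin 2) ℂ) → ℝ :=
      fun U => heightDensityCan F γ hJK (histGood F ℰp (θBal F.L γ b₀ p₀) K J) U with hg
    set B : GaugeField (F.P J) 0 (Matrix.specialUnitaryGroup (Fin 2) ℂ) → ℝ :=
      fun U => (F.scheme ℰp γ).β K * minActionRegPr F J K hJK ε₀ U with hB
    set d : ℝ := (b.src.tdist b'.src : ℝ) with hd
    have hd0 : 0 ≤ d := by rw [hd]; exact Nat.cast_nonneg _
    have hsplit : ((Real.log (ρ U) + B U) - (Real.log (ρ V) + B V)) - ((Real.log (ρ W) + B W) - (Real.log (ρ Z) + B Z))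
        = (((Real.log (g U) + B U) - (Real.log (g V) + B V)) - ((Real.log (g W) + B W) - (Real.log (g Z) + B Z)))
          + (((Real.log (ρ U) - Real.log (g U)) - (Real.log (ρ V) - Real.log (g V)))
              - ((Real.log (ρ W) - Real.log (g W)) - (Real.log (ρ Z) - Real.log (g Z)))) := by ring
    have eS : Real.exp (-(κS * d)) ≤ Real.exp (-(min κS κL * d)) :=
      Real.exp_le_exp.mpr (by nlinarith [min_le_left κS κL])
    have eL : Real.exp (-(κL * d)) ≤ Real.exp (-(min κS κL * d)) :=
      Real.exp_le_exp.mpr (by nlinarith [min_le_right κS κL])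
    have hΦJ := hΦ0 J
    have hΨJ := hΨ0 J
    show |((Real.log (ρ U) + B U) - (Real.log (ρ V) + B V)) - ((Real.log (ρ W) + B W) - (Real.log (ρ Z) + B Z))|
        ≤ 4 * (Φ J + Ψ J) * Real.exp (-(min κS κL * d))
    rw [hsplit]
    refine (abs_add_le _ _).trans ?_
    calc |((Real.log (g U) + B U) - (Real.log (g V) + B V)) - ((Real.log (g W) + B W) - (Real.log (g Z) + B Z))|
          + |((Real.log (ρ U) - Real.log (g U)) - (Real.log (ρ V) - Real.log (g V)))
              - ((Real.log (ρ W) - Real.log (g W)) - (Real.log (ρ Z) - Real.log (g Z)))|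
        ≤ 4 * Φ J * Real.exp (-(κS * d)) + 4 * Ψ J * Real.exp (-(κL * d)) := add_le_add h1 h2
      _ ≤ 4 * Φ J * Real.exp (-(min κS κL * d)) + 4 * Ψ J * Real.exp (-(min κS κL * d)) := by
          gcongr
      _ = 4 * (Φ J + Ψ J) * Real.exp (-(min κS κL * d)) := by ring

/-! ## §4 Stubs and the S2β this file delivers -/

/-- WREG stub — organ «window regularity of the small-field fibre density» (shared with `semiclassical_s2beta`; table = LINE g18-2 `Lines/wreg_chart.lean` —
**CLOSED BY NAME** (F6 ✓p734433 `Summit.QuantumFields.YangMills.Theorems.FluctuationComparisonRegPrIntLWreg.windowRegularity`, the Theorems-side port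
of `Lines/wreg_chart.lean` v20 @7e8eb395e5b4 `windowRegularity_of_stubs`; `Iff.rfl`-identical `WindowRegularity`)).
[cite: Balaban1985Averaging, (10) p.19; Balaban1987RG1, (2.10) p.267] -/
theorem stub_windowRegularity : WindowRegularity := Summit.QuantumFields.YangMills.Theorems.FluctuationComparisonRegPrIntLWreg.windowRegularity

/-- SFN stub (row 1 of the table: the small-field cluster expansion, norm only). [cite: Balaban1987RG1, Thm 1 (0.19)-(0.26)] -/
theorem stub_smallFieldPolymerNormCan : SmallFieldPolymerNormCan := by
  sorry

/-- **SFRᶜ FROM THE ORGANS** (v3): no longer a free-standing stub. [cite: Balaban1987RG1, Thm 1 (0.19)-(0.26)] -/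
theorem smallFieldPolymerRepCan_of_stubs : SmallFieldPolymerRepCan :=
  smallFieldPolymerRepCan_of_organs stub_windowRegularity stub_smallFieldPolymerNormCan

/-- LFRᶜ stub (row 2 of the table: the large-field R-operation). [cite: Balaban1988Convergent, §2 (2.18)-(2.27)] -/
theorem stub_largeFieldPolymerRepCan : LargeFieldPolymerRepCan := by
  sorry

/-- **S2β FROM THE TABLE** (v3): the package's registered input `FluctuationPartSmall` (v15 text, unchanged), from the stubs by the proved composition over the
canonical version. [cite: Balaban1985UV3, (41) p.266] -/
theorem fluctuationPartSmall_of_stubs : FluctuationPartSmall :=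
  fluctuationPartSmall_of_tables smallFieldPolymerRepCan_of_stubs stub_largeFieldPolymerRepCan

end Summit.QuantumFields.YangMills.Cruxes.FluctuationComparisonRegPrIntL.RunPairOrgan.PolymerNorm

end
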